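import Literature.AlgebraicGeometry.Modules.QuasicoherentColimits
import Mathlib.CategoryTheory.EssentiallySmall
import HarnessLib

/-!
# Colimits of quasi-coherent modules over essentially small index categories (Stacks 01LA (2), all universes)

Layer `Literature/AlgebraicGeometry/Modules` (0 definitions, 0 named facts, no instances, no notation). The tree's
`Modules/QuasicoherentColimits.isQuasicoherent_colimit` (The Stacks Project, Tag 01LA (2): "Any colimit of quasi-coherent
sheaves (in `Mod(𝒪_X)`) is quasi-coherent") is stated for diagrams `F : J ⥤ Mod(𝒪_X)` indexed by a SMALL category `J` IN THE
UNIVERSE `u` OF `X` (`{J : Type u} [SmallCategory J]`). The finite diagrams of Mathlib (`WalkingSpan`, `WalkingParallelPair`,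
`Discrete (Fin n)`, …) live in `Type 0`, so for a scheme in a universe `u ≠ 0` the tree's theorem does not apply to
pushouts, coequalizers or finite coproducts literally. This file DERIVES (without touching the accepted statement) the
universe-polymorphic form: for any ESSENTIALLY `u`-SMALL index category `J : Type w`, `[Category.{w'} J]` — in particular every
`u`-small category with `u`-small hom-sets (`essentiallySmall_of_small_of_locallySmall`), hence every finite or countable
category in any universe — colimits of quasi-coherent modules are quasi-coherent: transport along Mathlib's small model
`equivSmallModel J : J ≌ SmallModel J` (`HasColimit.isoOfEquivalence`), quasi-coherence being invariant under isomorphism.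

* **`isQuasicoherent_colimit_of_essentiallySmall`**, `IsAffineLocalizing.colimit_of_essentiallySmall`;
* the finite shapes by name: **`isQuasicoherent_pushout`**, `IsAffineLocalizing.pushout` (Stacks 01LA (2) for
  `M ⨿_L N = colim (M ← L → N)`).

Everything is proved; no named fact. Library only (cell `pub-hodge-ring2`, count-neutral; proves nothing about any crux, route
or conjecture). Mathlib searched (pin v4.32): `equivSmallModel`, `HasColimit.isoOfEquivalence`,
`essentiallySmall_of_small_of_locallySmall`, `small_zero`, `locallySmall_of_univLE` (used).

## References

* The Stacks Project, Tag 01LA (2) (colimits of quasi-coherent modules). [StacksProject]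
* U. Görtz, T. Wedhorn, *Algebraic Geometry I*, 2nd ed. (2020), Cor. 7.19 (1)–(3). [GortzWedhorn2020]
-/

noncomputable section

set_option backward.isDefEq.respectTransparency false -- `Scheme.Modules` is not reducible (as in Mathlib)

open CategoryTheory CategoryTheory.Limits AlgebraicGeometry

universe w' w u

namespace Literature.AlgebraicGeometry.Modules

variable {X : Scheme.{u}}

/-- **Stacks 01LA (2) over an essentially small index category**: for `J` essentially `u`-small (e.g. any small category
with small hom-sets in a universe `≤ u`, any finite category) and a diagram `F : J ⥤ Mod(𝒪_X)` of quasi-coherent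
modules, `colim F` is quasi-coherent. Derived from the tree's `isQuasicoherent_colimit` (index categories in `Type u`) by
transport along Mathlib's small model `J ≌ SmallModel J`. [cite: StacksProject, Tag 01LA] [cite: GortzWedhorn2020, Cor. 7.19] -/
theorem isQuasicoherent_colimit_of_essentiallySmall {J : Type w} [Category.{w'} J] [EssentiallySmall.{u} J]
    (F : J ⥤ X.Modules) [HasColimit F] [∀ j, (F.obj j).IsQuasicoherent] : (colimit F).IsQuasicoherent := by
  let e : SmallModel.{u} J ≌ J := (equivSmallModel.{u} J).symm
  haveI : ∀ j, ((e.functor ⋙ F).obj j).IsQuasicoherent := fun j =>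
    inferInstanceAs (F.obj (e.functor.obj j)).IsQuasicoherent
  haveI := isQuasicoherent_colimit (e.functor ⋙ F)
  exact (SheafOfModules.isQuasicoherent X.ringCatSheaf).prop_of_iso
    (HasColimit.isoOfEquivalence (F := e.functor ⋙ F) (G := F) e (Iso.refl _)) this

/-- Stacks 01LA (2) over an essentially small index category, for the tree's predicate `IsAffineLocalizing`.
[cite: StacksProject, Tag 01LA] [cite: GortzWedhorn2020, Cor. 7.19] -/
theorem IsAffineLocalizing.colimit_of_essentiallySmall {J : Type w} [Category.{w'} J] [EssentiallySmall.{u} J]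
    (F : J ⥤ X.Modules) [HasColimit F] (hF : ∀ j, IsAffineLocalizing (F.obj j)) :
    IsAffineLocalizing (Limits.colimit F) := by
  haveI : ∀ j, (F.obj j).IsQuasicoherent := fun j => isQuasicoherent_of_isAffineLocalizing (hF j)
  haveI := isQuasicoherent_colimit_of_essentiallySmall F
  exact IsAffineLocalizing.of_isQuasicoherent _

/-- **A pushout `M ⨿_L N` of quasi-coherent modules is quasi-coherent** (Stacks 01LA (2) for the finite diagram
`M ← L → N`, in every universe). [cite: StacksProject, Tag 01LA] [cite: GortzWedhorn2020, Cor. 7.19] -/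
theorem isQuasicoherent_pushout {L M N : X.Modules} (f : L ⟶ M) (g : L ⟶ N) [L.IsQuasicoherent] [M.IsQuasicoherent]
    [N.IsQuasicoherent] : (pushout f g).IsQuasicoherent := by
  haveI : ∀ j, ((span f g).obj j).IsQuasicoherent := by
    rintro (_ | _ | _)
    · exact inferInstanceAs L.IsQuasicoherent
    · exact inferInstanceAs M.IsQuasicoherent
    · exact inferInstanceAs N.IsQuasicoherent
  exact isQuasicoherent_colimit_of_essentiallySmall (span f g)

/-- A pushout of affine-localizing modules is affine-localizing. [cite: StacksProject, Tag 01LA] [cite: GortzWedhorn2020, Cor. 7.19] -/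
theorem IsAffineLocalizing.pushout {L M N : X.Modules} (f : L ⟶ M) (g : L ⟶ N) (hL : IsAffineLocalizing L)
    (hM : IsAffineLocalizing M) (hN : IsAffineLocalizing N) : IsAffineLocalizing (Limits.pushout f g) := by
  haveI := isQuasicoherent_of_isAffineLocalizing hL
  haveI := isQuasicoherent_of_isAffineLocalizing hM
  haveI := isQuasicoherent_of_isAffineLocalizing hN
  haveI := isQuasicoherent_pushout f g
  exact IsAffineLocalizing.of_isQuasicoherent _

end Literature.AlgebraicGeometry.Modules

end
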